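import Literature.Analysis.SpecialFunctions.RiemannThetaTransformationKappa
import HarnessLib

/-!
# Theta nulls under the theta group: `ϑ(0, M(Z))² = u(M) det(γZ + δ) ϑ(0, Z)²` (Lange Thm. 3.3.9 / Mumford II §5)

For `M = (α β; γ δ)` in the theta group `Γ_{1,2} ⊂ Sp_{2g}(ℤ)` (the tree's `thetaModularGroup g`,
Lange §3.5.1 Lemma 3.5.1) the transformed characteristic `M[0]` is integral, so the Theta
Transformation Formula (Lange Thm. 3.3.9; Mumford, *Tata Lectures on Theta I*, Ch. II §5) reads
`ϑ(ᵗ(γZ + δ)⁻¹v, M(Z)) = C(Z, M) · e(πi ᵗv(γZ + δ)⁻¹γv) · ϑ(v, Z)` with Riemann's `ϑ = ϑ[0; 0]` on both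
sides (the tree's `SiegelThetaModularGroup.exists_riemannTheta_transform_of_mem_thetaModularGroup`, "up
to the constant"). With the constant now determined up to sign by
`RiemannThetaTransformationKappa.exists_unit_sq_riemannThetaChar_transform_const_eq_mul_det_denom`
(`C(Z, M)² = u(M) det(γZ + δ)`, `|u(M)| = 1`) and in modulus by
`RiemannThetaTransformationModulus.norm_sq_riemannThetaChar_transform_const` (`|C|² = |det(γZ + δ)|`):

* `exists_unit_sq_riemannTheta_transform_const_of_mem_thetaModularGroup` — for `M ∈ Γ_{1,2}` there is
  `u = u(M)`, `|u| = 1`, with `C² = u det(γZ + δ)` for every `Z ∈ 𝔥_g` and every constant `C` of the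
  `ϑ`-transformation law above;
* `norm_sq_riemannTheta_transform_const_of_mem_thetaModularGroup` — `|C|² = |det(γZ + δ)|`;
* **`exists_unit_riemannTheta_zero_moeb_sq`** — the THETA NULL: `ϑ(0, M(Z))² = u(M) det(γZ + δ) ϑ(0, Z)²`
  for all `Z ∈ 𝔥_g` ("`ϑ(0, Z)²` is a modular form of weight one for `Γ_{1,2}` with multiplier `u`");
  `norm_sq_riemannTheta_zero_moeb` — `|ϑ(0, M(Z))|² = |det(γZ + δ)| |ϑ(0, Z)|²`;
* `exists_unit_riemannThetaChar_zero_moeb_sq` — for every `M ∈ Sp_{2g}(ℤ)`: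
  `ϑ[M[0]](0, M(Z))² = u(M) det(γZ + δ) ϑ(0, Z)²` (Lange's use of Thm. 3.3.9 for theta null values,
  §3.5.1 proof of Prop. 3.5.2, here for `D = 1_g`, `ℓ = 0`).

Theorems only; no definitions, no named facts.

## References

* [Lange2023AbelianVarietiesComplex] H. Lange, *Abelian Varieties over the Complex Numbers* (2023),
  §3.3.3 Thm. 3.3.9 (p0175–p0177); §3.5.1 Lemma 3.5.1, proof of Prop. 3.5.2 ("ϑ[…](0, M(Z)) =
  κ(M) det(γZ + δ)^{1/2} e(πi k(M, D⁻¹ℓ, 0)) ϑ[D⁻¹ℓ; 0](0, Z)") (p0186–p0187).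
* [MumfordTata1] D. Mumford, *Tata Lectures on Theta I* (1983), Ch. II §5 (the functional equation of
  `ϑ(z, Ω)` for `Γ_{1,2}`, with an eighth root of unity and `det(CΩ + D)^{1/2}`).
-/

noncomputable section

open Matrix Complex Real

namespace Literature.NumberTheory.ModularForms

open Literature.NumberTheory.Automorphic (siegelUpperHalfSpace)
open Literature.NumberTheory.ModularForms.SiegelUpperHalfSpace
open Literature.Analysis.SpecialFunctions

variable {g : ℕ}

/-- For `M ∈ Γ_{1,2}` the `ϑ`-transformation law with constant `C` is the `ϑ[M[0]]`-transformation law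
of Thm. 3.3.9 at `c = 0` with the same constant (`M[0]` is integral and `ϑ[n¹; n²] = ϑ` for integral
characteristics). [cite: Lange2023AbelianVarietiesComplex, §3.5.1 Lemma 3.5.1 (a) (p0186); §3.3.4 Exercise (3) (p0178)] -/
theorem riemannThetaChar_transform_of_riemannTheta_transform {M : Matrix.symplecticGroup (Fin g) ℤ}
    (hM : M ∈ thetaModularGroup g) {Z : Matrix (Fin g) (Fin g) ℂ} {C : ℂ}
    (hC : ∀ v : Fin g → ℂ,
      riemannTheta (moeb ((M : Matrix (Fin g ⊕ Fin g) (Fin g ⊕ Fin g) ℤ).map ((↑) : ℤ → ℂ)) Z)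
          ((denom ((M : Matrix (Fin g ⊕ Fin g) (Fin g ⊕ Fin g) ℤ).map ((↑) : ℤ → ℂ)) Z)ᵀ⁻¹ *ᵥ v) =
        C * cexp (π * I * (v ⬝ᵥ ((denom ((M : Matrix (Fin g ⊕ Fin g) (Fin g ⊕ Fin g) ℤ).map
              ((↑) : ℤ → ℂ)) Z)⁻¹ *
            ((M : Matrix (Fin g ⊕ Fin g) (Fin g ⊕ Fin g) ℤ).map ((↑) : ℤ → ℂ)).toBlocks₂₁) *ᵥ v)) *
          riemannTheta Z v) (v : Fin g → ℂ) :
    riemannThetaChar (thetaCharFst (M : Matrix (Fin g ⊕ Fin g) (Fin g ⊕ Fin g) ℤ) 0 0)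
        (thetaCharSnd (M : Matrix (Fin g ⊕ Fin g) (Fin g ⊕ Fin g) ℤ) 0 0)
        (moeb ((M : Matrix (Fin g ⊕ Fin g) (Fin g ⊕ Fin g) ℤ).map ((↑) : ℤ → ℂ)) Z)
        ((denom ((M : Matrix (Fin g ⊕ Fin g) (Fin g ⊕ Fin g) ℤ).map ((↑) : ℤ → ℂ)) Z)ᵀ⁻¹ *ᵥ v) =
      C * cexp (π * I * (v ⬝ᵥ ((denom ((M : Matrix (Fin g ⊕ Fin g) (Fin g ⊕ Fin g) ℤ).map
            ((↑) : ℤ → ℂ)) Z)⁻¹ *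
          ((M : Matrix (Fin g ⊕ Fin g) (Fin g ⊕ Fin g) ℤ).map ((↑) : ℤ → ℂ)).toBlocks₂₁) *ᵥ v)) *
        riemannThetaChar 0 0 Z v := by
  obtain ⟨n₁, n₂, h₁, h₂⟩ := (mem_thetaModularGroup_iff_thetaChar_zero M).1 hM
  rw [h₁, h₂, show (fun i ↦ (n₁ i : ℂ)) = 0 + fun i ↦ (n₁ i : ℂ) from (zero_add _).symm,
    show (fun i ↦ (n₂ i : ℂ)) = 0 + fun i ↦ (n₂ i : ℂ) from (zero_add _).symm,
    riemannThetaChar_charShift, zero_dotProduct, mul_zero, Complex.exp_zero, one_mul,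
    riemannThetaChar_zero_zero, riemannThetaChar_zero_zero]
  exact hC v

/-- **Thm. 3.3.9 for the theta group, squared constant**: for `M = (α β; γ δ) ∈ Γ_{1,2}` there is a
unit `u = u(M) ∈ ℂ`, `|u| = 1`, depending only on `M`, such that every constant `C` with
`ϑ(ᵗ(γZ + δ)⁻¹v, M(Z)) = C · e(πi ᵗv(γZ + δ)⁻¹γv) · ϑ(v, Z)` (`Z ∈ 𝔥_g`) satisfies
`C² = u · det(γZ + δ)` — Mumford's "`ζ_γ det(CΩ + D)^{1/2}`", squared.
[cite: Lange2023AbelianVarietiesComplex, §3.3.3 Thm. 3.3.9 (p0175); §3.5.1 Lemma 3.5.1 (p0186)] [cite: MumfordTata1, Ch. II §5] -/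
theorem exists_unit_sq_riemannTheta_transform_const_of_mem_thetaModularGroup
    {M : Matrix.symplecticGroup (Fin g) ℤ} (hM : M ∈ thetaModularGroup g) :
    ∃ u : ℂ, ‖u‖ = 1 ∧ ∀ (Z : Matrix (Fin g) (Fin g) ℂ), Z ∈ siegelUpperHalfSpace g → ∀ (C : ℂ),
      (∀ v : Fin g → ℂ,
        riemannTheta (moeb ((M : Matrix (Fin g ⊕ Fin g) (Fin g ⊕ Fin g) ℤ).map ((↑) : ℤ → ℂ)) Z)
            ((denom ((M : Matrix (Fin g ⊕ Fin g) (Fin g ⊕ Fin g) ℤ).map ((↑) : ℤ → ℂ)) Z)ᵀ⁻¹ *ᵥ v) =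
          C * cexp (π * I * (v ⬝ᵥ ((denom ((M : Matrix (Fin g ⊕ Fin g) (Fin g ⊕ Fin g) ℤ).map
                ((↑) : ℤ → ℂ)) Z)⁻¹ *
              ((M : Matrix (Fin g ⊕ Fin g) (Fin g ⊕ Fin g) ℤ).map ((↑) : ℤ → ℂ)).toBlocks₂₁) *ᵥ v)) *
            riemannTheta Z v) →
      C ^ 2 = u * (denom ((M : Matrix (Fin g ⊕ Fin g) (Fin g ⊕ Fin g) ℤ).map ((↑) : ℤ → ℂ)) Z).det := by
  obtain ⟨u, hu, h⟩ := exists_unit_sq_riemannThetaChar_transform_const_eq_mul_det_denom M.2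
  exact ⟨u, hu, fun Z hZ C hC =>
    h Z hZ C (riemannThetaChar_transform_of_riemannTheta_transform hM hC)⟩

/-- **The modulus of the constant for the theta group**: `|C|² = |det(γZ + δ)|` for every constant
`C` of the `ϑ`-transformation law of `M ∈ Γ_{1,2}` at `Z ∈ 𝔥_g`.
[cite: Lange2023AbelianVarietiesComplex, §3.3.3 proof of Thm. 3.3.9, Step II (p0177); §3.5.1 Lemma 3.5.1 (p0186)] [cite: MumfordTata1, Ch. II §5] -/
theorem norm_sq_riemannTheta_transform_const_of_mem_thetaModularGroup
    {M : Matrix.symplecticGroup (Fin g) ℤ} (hM : M ∈ thetaModularGroup g)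
    {Z : Matrix (Fin g) (Fin g) ℂ} (hZ : Z ∈ siegelUpperHalfSpace g) {C : ℂ}
    (hC : ∀ v : Fin g → ℂ,
      riemannTheta (moeb ((M : Matrix (Fin g ⊕ Fin g) (Fin g ⊕ Fin g) ℤ).map ((↑) : ℤ → ℂ)) Z)
          ((denom ((M : Matrix (Fin g ⊕ Fin g) (Fin g ⊕ Fin g) ℤ).map ((↑) : ℤ → ℂ)) Z)ᵀ⁻¹ *ᵥ v) =
        C * cexp (π * I * (v ⬝ᵥ ((denom ((M : Matrix (Fin g ⊕ Fin g) (Fin g ⊕ Fin g) ℤ).map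
              ((↑) : ℤ → ℂ)) Z)⁻¹ *
            ((M : Matrix (Fin g ⊕ Fin g) (Fin g ⊕ Fin g) ℤ).map ((↑) : ℤ → ℂ)).toBlocks₂₁) *ᵥ v)) *
          riemannTheta Z v) :
    ‖C‖ ^ 2 = ‖(denom ((M : Matrix (Fin g ⊕ Fin g) (Fin g ⊕ Fin g) ℤ).map ((↑) : ℤ → ℂ)) Z).det‖ :=
  norm_sq_riemannThetaChar_transform_const M.2 hZ
    (riemannThetaChar_transform_of_riemannTheta_transform hM hC)

/-- **Theta nulls under the theta group**: for `M = (α β; γ δ) ∈ Γ_{1,2}` there is `u = u(M)`,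
`|u| = 1`, with **`ϑ(0, M(Z))² = u · det(γZ + δ) · ϑ(0, Z)²`** for all `Z ∈ 𝔥_g` — the theta null
`ϑ(0, ·)²` is a modular form of weight `1` for `Γ_{1,2}` with the multiplier `u` (the transformation law
at `v = 0`, squared).
[cite: Lange2023AbelianVarietiesComplex, §3.3.3 Thm. 3.3.9 (p0175); §3.5.1 proof of Prop. 3.5.2 (p0187)] [cite: MumfordTata1, Ch. II §5] -/
theorem exists_unit_riemannTheta_zero_moeb_sq {M : Matrix.symplecticGroup (Fin g) ℤ}
    (hM : M ∈ thetaModularGroup g) :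
    ∃ u : ℂ, ‖u‖ = 1 ∧ ∀ (Z : Matrix (Fin g) (Fin g) ℂ), Z ∈ siegelUpperHalfSpace g →
      riemannTheta (moeb ((M : Matrix (Fin g ⊕ Fin g) (Fin g ⊕ Fin g) ℤ).map ((↑) : ℤ → ℂ)) Z) 0 ^ 2 =
        u * (denom ((M : Matrix (Fin g ⊕ Fin g) (Fin g ⊕ Fin g) ℤ).map ((↑) : ℤ → ℂ)) Z).det *
          riemannTheta Z 0 ^ 2 := by
  obtain ⟨u, hu, h⟩ := exists_unit_sq_riemannTheta_transform_const_of_mem_thetaModularGroup hM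
  refine ⟨u, hu, fun Z hZ => ?_⟩
  obtain ⟨C, -, hC⟩ := exists_riemannTheta_transform_of_mem_thetaModularGroup hM hZ
  have h0 := hC 0
  rw [mulVec_zero, mulVec_zero, dotProduct_zero, mul_zero, Complex.exp_zero, mul_one] at h0
  rw [h0, mul_pow, h Z hZ C hC]

/-- **`|ϑ(0, M(Z))|² = |det(γZ + δ)| · |ϑ(0, Z)|²`** for `M ∈ Γ_{1,2}`, `Z ∈ 𝔥_g` (the theta null has
"weight ½" in absolute value). [cite: Lange2023AbelianVarietiesComplex, §3.3.3 proof of Thm. 3.3.9, Step II (p0177); §3.5.1 (p0186–p0187)] [cite: MumfordTata1, Ch. II §5] -/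
theorem norm_sq_riemannTheta_zero_moeb {M : Matrix.symplecticGroup (Fin g) ℤ}
    (hM : M ∈ thetaModularGroup g) {Z : Matrix (Fin g) (Fin g) ℂ} (hZ : Z ∈ siegelUpperHalfSpace g) :
    ‖riemannTheta (moeb ((M : Matrix (Fin g ⊕ Fin g) (Fin g ⊕ Fin g) ℤ).map ((↑) : ℤ → ℂ)) Z) 0‖ ^ 2 =
      ‖(denom ((M : Matrix (Fin g ⊕ Fin g) (Fin g ⊕ Fin g) ℤ).map ((↑) : ℤ → ℂ)) Z).det‖ *
        ‖riemannTheta Z 0‖ ^ 2 := by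
  obtain ⟨C, -, hC⟩ := exists_riemannTheta_transform_of_mem_thetaModularGroup hM hZ
  have h0 := hC 0
  rw [mulVec_zero, mulVec_zero, dotProduct_zero, mul_zero, Complex.exp_zero, mul_one] at h0
  rw [h0, norm_mul, mul_pow, norm_sq_riemannTheta_transform_const_of_mem_thetaModularGroup hM hZ hC]

/-- **Theta nulls with characteristic under all of `Sp_{2g}(ℤ)`**: for `M = (α β; γ δ) ∈ Sp_{2g}(ℤ)`
there is `u = u(M)`, `|u| = 1`, with `ϑ[M[0]](0, M(Z))² = u · det(γZ + δ) · ϑ(0, Z)²` for all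
`Z ∈ 𝔥_g` (Thm. 3.3.9 at `c = 0`, `v = 0`, squared — Lange's use of the transformation formula for
theta null values in the proof of Prop. 3.5.2, here for `D = 1_g`).
[cite: Lange2023AbelianVarietiesComplex, §3.3.3 Thm. 3.3.9 (p0175); §3.5.1 proof of Prop. 3.5.2 (p0187)] -/
theorem exists_unit_riemannThetaChar_zero_moeb_sq {M : Matrix (Fin g ⊕ Fin g) (Fin g ⊕ Fin g) ℤ}
    (hM : M ∈ Matrix.symplecticGroup (Fin g) ℤ) :
    ∃ u : ℂ, ‖u‖ = 1 ∧ ∀ (Z : Matrix (Fin g) (Fin g) ℂ), Z ∈ siegelUpperHalfSpace g →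
      riemannThetaChar (thetaCharFst M 0 0) (thetaCharSnd M 0 0) (moeb (M.map ((↑) : ℤ → ℂ)) Z) 0 ^ 2 =
        u * (denom (M.map ((↑) : ℤ → ℂ)) Z).det * riemannTheta Z 0 ^ 2 := by
  obtain ⟨u, hu, h⟩ := exists_unit_sq_riemannThetaChar_transform_const_eq_mul_det_denom hM
  refine ⟨u, hu, fun Z hZ => ?_⟩
  obtain ⟨C, -, hC⟩ := exists_riemannThetaChar_transform hM hZ 0 0
  have h0 := hC 0
  rw [mulVec_zero, mulVec_zero, dotProduct_zero, mul_zero, Complex.exp_zero, mul_one,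
    riemannThetaChar_zero_zero] at h0
  rw [h0, mul_pow, h Z hZ C hC]

/-- **`|ϑ[M[0]](0, M(Z))|² = |det(γZ + δ)| · |ϑ(0, Z)|²`** for every `M ∈ Sp_{2g}(ℤ)`, `Z ∈ 𝔥_g`.
[cite: Lange2023AbelianVarietiesComplex, §3.3.3 proof of Thm. 3.3.9, Step II (p0177); §3.5.1 proof of Prop. 3.5.2 (p0187)] -/
theorem norm_sq_riemannThetaChar_zero_moeb {M : Matrix (Fin g ⊕ Fin g) (Fin g ⊕ Fin g) ℤ}
    (hM : M ∈ Matrix.symplecticGroup (Fin g) ℤ) {Z : Matrix (Fin g) (Fin g) ℂ}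
    (hZ : Z ∈ siegelUpperHalfSpace g) :
    ‖riemannThetaChar (thetaCharFst M 0 0) (thetaCharSnd M 0 0) (moeb (M.map ((↑) : ℤ → ℂ)) Z) 0‖ ^ 2 =
      ‖(denom (M.map ((↑) : ℤ → ℂ)) Z).det‖ * ‖riemannTheta Z 0‖ ^ 2 := by
  obtain ⟨C, -, hC⟩ := exists_riemannThetaChar_transform hM hZ 0 0
  have h0 := hC 0
  rw [mulVec_zero, mulVec_zero, dotProduct_zero, mul_zero, Complex.exp_zero, mul_one,
    riemannThetaChar_zero_zero] at h0
  rw [h0, norm_mul, mul_pow, norm_sq_riemannThetaChar_transform_const hM hZ hC]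

end Literature.NumberTheory.ModularForms

end
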